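import Mathlib
import Summits.ValiantsHypothesis.ValiantsHypothesis.Theorems.BarrierLeverSuccinctHittingSetsForVPSeparableCoeffThreeChain
import HarnessLib

/-!
# Separable coefficient tensors at exponent 3, III: step costs, the count `≤ n³`, the theorem
(crux stmt-ValiantsHypothesis-14610 side; docket 8745/8749 of seat val-np-p5)

Three files (`…SeparableCoeffThreeEngine`, `…SeparableCoeffThreeChain`, `…SeparableCoeffThree`) prove:
for every `n ≥ 6` and every table of univariate coefficient sequences `c_l : ℕ → ℂ` (`l < n`)
there is `Λ ∈ SmallCircuits ℂ n 3` (degree `≤ n`, fan-in-two size `≤ n³`) with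
`coeff_μ Λ = ∏_l c_l(μ_l)` for every `|μ| ≤ n` (`separableCoeff_three`). The tree's
`stub_separableCoeff` has the same conclusion at exponent `8` (truncation by interpolation, no
sharing); here the degree-`≤ n` truncation `Λ = Σ_{d ≤ n} (∏_l G_l(x_l))_d`,
`G_l = Σ_{k ≤ n} c_l(k) x_l^k`, is computed by the truncated-product dynamic programme
`P_{i+1,d} = Σ_{k ≤ d} c_i(k) x_i^k P_{i,d-k}` (`P_{i,d}` = degree-`d` part of `∏_{l<i} G_l`), all
entries sharing ONE circuit via the tree's chain bound `complexity_chain_le` (Bürgisser 2000,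
Rem. 2.7). The table — powers `x_l^k`, rows `P_{i,·}` (`i = 1, …, n-1`), prefix sums
`S_j = Σ_{d ≤ j} P_{n-1,d}`, and the output `Λ = Σ_k c_{n-1}(k) x_{n-1}^k S_{n-k}` — is indexed by
the finite linear order `Idx n = Fin 3 ×ₗ (Fin n ×ₗ Fin (n+1))` (block, row, column); its sharp cost
is `n(n-1) + n + (n-2)n² + n + (2n-1) = n³ - n² + 3n - 1` (`(d-1)` products and `d` weighted
additions per middle entry); the files prove the cruder `≤ n³` for `n ≥ 6`.

THIS FILE: the step costs (`complexity_yv`, `complexity_xin`, `complexity_termP_le`,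
`complexity_termT_le`, `complexity_stepN_le : L(stepN a b e) ≤ costN n a b e`), the count
(`sum_costN_le`: `Σ costN ≤ n(n+1) + (n+1) + (n-2)n² + (n+1) + (2n-1) ≤ n³` for `n ≥ 6`;
`sum_complexity_step_le`), and the theorem `separableCoeff_three`. No definitions.

Honest framing: 14610-side bookkeeping (the cost of FSV's Construction 25 in regime `d = n`);
consumers are the factorial polynomial / principal catalecticant minors at exponent `3` (tree: `8`);
nothing here bears on the open cruxes or on `VP ≠ VNP`.

References: [ForbesShpilkaVolk2018] Construction 25, Fact 26; [Burgisser2000] Def. 2.1, Rem. 2.7.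
-/

-- layout Summits/ValiantsHypothesis/ValiantsHypothesis forces the duplicated namespace component
set_option linter.dupNamespace false

noncomputable section

namespace Summit.ValiantsHypothesis.ValiantsHypothesis.Theorems.BarrierLever.SuccinctHittingSetsForVP

open Literature.Barriers.ValiantsHypothesis Literature.Computability.AlgebraicComplexity MvPolynomial

namespace SeparableCoeffThree

/-! ### E. Step costs and the total count -/

section Count

variable {n : ℕ} (c : Fin n → ℕ → ℂ)

/-- `L(Y_{(a,b,e)}) = 0`. [folklore] -/
theorem complexity_yv (a b e : ℕ) :
    complexity (yv a b e : MvPolynomial (Fin n ⊕ Idx n) ℂ) = 0 := by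
  unfold yv
  split_ifs
  · exact complexity_X_holds _
  · rw [← C_0, complexity_C_holds]

/-- `L(x_b) = 0`. [folklore] -/
theorem complexity_xin (b : ℕ) : complexity (xin b : MvPolynomial (Fin n ⊕ Idx n) ℂ) = 0 := by
  unfold xin
  split_ifs
  · exact complexity_X_holds _
  · rw [← C_0, complexity_C_holds]

/-- A sum over `{0, …, e}` whose end terms vanish and whose middle terms are `≤ 1` is `≤ e - 1`.
[folklore] -/
theorem sum_le_pred_of_ends {g : ℕ → ℕ} {e : ℕ} (he : 1 ≤ e) (h0 : g 0 = 0) (hlast : g e = 0)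
    (hmid : ∀ k, 0 < k → k < e → g k ≤ 1) : ∑ k ∈ Finset.range (e + 1), g k ≤ e - 1 := by
  obtain ⟨e', rfl⟩ : ∃ e', e = e' + 1 := ⟨e - 1, by omega⟩
  rw [Finset.sum_range_succ, hlast, add_zero, Finset.sum_range_succ', h0, add_zero]
  calc ∑ k ∈ Finset.range e', g (k + 1) ≤ ∑ _k ∈ Finset.range e', 1 :=
        Finset.sum_le_sum fun k hk => hmid (k + 1) (Nat.succ_pos k)
          (by have := Finset.mem_range.mp hk; omega)
    _ = e' + 1 - 1 := by simp

/-- `L(termP b e k) ≤ [0 < k < e]`. [folklore] -/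
theorem complexity_termP_le (b e k : ℕ) :
    complexity (termP b e k : MvPolynomial (Fin n ⊕ Idx n) ℂ) ≤ if 0 < k ∧ k < e then 1 else 0 := by
  unfold termP
  by_cases hk0 : k = 0
  · rw [if_pos hk0, complexity_yv, if_neg (by omega)]
  · rw [if_neg hk0]
    by_cases hke : k < e
    · rw [if_pos hke, if_pos ⟨Nat.pos_of_ne_zero hk0, hke⟩]
      calc complexity (yv 0 b k * yv 1 (b - 1) (e - k) : MvPolynomial (Fin n ⊕ Idx n) ℂ)
          ≤ complexity (yv 0 b k : MvPolynomial (Fin n ⊕ Idx n) ℂ) +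
              complexity (yv 1 (b - 1) (e - k) : MvPolynomial (Fin n ⊕ Idx n) ℂ) + 1 :=
            complexity_mul_le_holds _ _
        _ = 1 := by rw [complexity_yv, complexity_yv]
    · rw [if_neg hke, complexity_yv, if_neg (by omega)]

/-- `L(termT k) ≤ [0 < k < n]`. [folklore] -/
theorem complexity_termT_le (k : ℕ) :
    complexity (termT k : MvPolynomial (Fin n ⊕ Idx n) ℂ) ≤ if 0 < k ∧ k < n then 1 else 0 := by
  unfold termT
  by_cases hk0 : k = 0
  · rw [if_pos hk0, complexity_yv, if_neg (by omega)]
  · rw [if_neg hk0]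
    by_cases hkn : k < n
    · rw [if_pos hkn, if_pos ⟨Nat.pos_of_ne_zero hk0, hkn⟩]
      calc complexity (yv 0 (n - 1) k * yv 2 0 (n - k) : MvPolynomial (Fin n ⊕ Idx n) ℂ)
          ≤ complexity (yv 0 (n - 1) k : MvPolynomial (Fin n ⊕ Idx n) ℂ) +
              complexity (yv 2 0 (n - k) : MvPolynomial (Fin n ⊕ Idx n) ℂ) + 1 :=
            complexity_mul_le_holds _ _
        _ = 1 := by rw [complexity_yv, complexity_yv]
    · rw [if_neg hkn, complexity_yv, if_neg (by omega)]

/-- `L(1) = 0` and `L(C a) = 0` in the step ring. [folklore] -/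
theorem complexity_one_step : complexity (1 : MvPolynomial (Fin n ⊕ Idx n) ℂ) = 0 := by
  rw [← C_1, complexity_C_holds]

/-- **Step costs**: `L(stepN a b e) ≤ costN n a b e` (for `n ≥ 2`). [cite: Burgisser2000, Def. 2.1] -/
theorem complexity_stepN_le (hn : 2 ≤ n) (a b e : ℕ) :
    complexity (stepN c a b e) ≤ costN n a b e := by
  unfold stepN costN
  by_cases ha0 : a = 0
  · simp only [if_pos ha0]
    by_cases he0 : e = 0
    · rw [if_pos he0, complexity_one_step]; exact Nat.zero_le _
    · rw [if_neg he0]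
      by_cases he1 : e = 1
      · rw [if_pos he1, complexity_xin]; exact Nat.zero_le _
      · rw [if_neg he1, if_pos (by omega)]
        calc complexity (xin b * yv 0 b (e - 1) : MvPolynomial (Fin n ⊕ Idx n) ℂ)
            ≤ complexity (xin b : MvPolynomial (Fin n ⊕ Idx n) ℂ) +
                complexity (yv 0 b (e - 1) : MvPolynomial (Fin n ⊕ Idx n) ℂ) + 1 :=
              complexity_mul_le_holds _ _
          _ = 1 := by rw [complexity_xin, complexity_yv]
  · simp only [if_neg ha0]
    by_cases ha1 : a = 1
    · simp only [if_pos ha1]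
      by_cases hbn : b + 2 ≤ n
      · simp only [if_pos hbn]
        by_cases hb0 : b = 0
        · simp only [if_pos hb0]
          by_cases he0 : e = 0
          · rw [if_pos he0, if_pos he0, complexity_C_holds]
          · rw [if_neg he0, if_neg he0]
            calc complexity (C (cN c 0 e) * yv 0 0 e : MvPolynomial (Fin n ⊕ Idx n) ℂ)
                ≤ complexity (C (cN c 0 e) : MvPolynomial (Fin n ⊕ Idx n) ℂ) +
                    complexity (yv 0 0 e : MvPolynomial (Fin n ⊕ Idx n) ℂ) + 1 :=
                  complexity_mul_le_holds _ _
              _ = 1 := by rw [complexity_C_holds, complexity_yv]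
        · simp only [if_neg hb0]
          by_cases he0 : e = 0
          · rw [if_pos he0, complexity_C_holds]; exact Nat.zero_le _
          · rw [if_neg he0]
            have he1 : 1 ≤ e := Nat.pos_of_ne_zero he0
            calc complexity (∑ k ∈ Finset.range (e + 1), coefP c b e k • termP b e k)
                ≤ ∑ k ∈ Finset.range (e + 1),
                    complexity (termP b e k : MvPolynomial (Fin n ⊕ Idx n) ℂ) + (e + 1 - 1) :=
                  complexity_wsum_le _ _ (e + 1) (by omega)
              _ ≤ (e - 1) + (e + 1 - 1) := by
                  gcongr
                  exact sum_le_pred_of_ends he1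
                    (le_antisymm ((complexity_termP_le b e 0).trans (by simp)) (Nat.zero_le _))
                    (le_antisymm ((complexity_termP_le b e e).trans (by simp)) (Nat.zero_le _))
                    (fun k hk hke => (complexity_termP_le b e k).trans (by rw [if_pos ⟨hk, hke⟩]))
              _ = 2 * e - 1 := by omega
      · rw [if_neg hbn, if_neg hbn, ← C_0, complexity_C_holds]
    · simp only [if_neg ha1]
      by_cases hb0 : b = 0
      · simp only [if_pos hb0]
        by_cases he0 : e = 0
        · rw [if_pos he0, if_pos he0, complexity_C_holds]
        · rw [if_neg he0, if_neg he0]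
          calc complexity (yv 2 0 (e - 1) + yv 1 (n - 2) e : MvPolynomial (Fin n ⊕ Idx n) ℂ)
              ≤ complexity (yv 2 0 (e - 1) : MvPolynomial (Fin n ⊕ Idx n) ℂ) +
                  complexity (yv 1 (n - 2) e : MvPolynomial (Fin n ⊕ Idx n) ℂ) + 1 :=
                complexity_add_le_holds _ _
            _ = 1 := by rw [complexity_yv, complexity_yv]
      · simp only [if_neg hb0]
        by_cases hb1 : b = 1 ∧ e = 0
        · rw [if_pos hb1, if_pos hb1]
          calc complexity (∑ k ∈ Finset.range (n + 1), coefT c k • termT k)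
              ≤ ∑ k ∈ Finset.range (n + 1),
                  complexity (termT k : MvPolynomial (Fin n ⊕ Idx n) ℂ) + (n + 1 - 1) :=
                complexity_wsum_le _ _ (n + 1) (by omega)
            _ ≤ (n - 1) + (n + 1 - 1) := by
                gcongr
                exact sum_le_pred_of_ends (by omega)
                  (le_antisymm ((complexity_termT_le (n := n) 0).trans (by simp)) (Nat.zero_le _))
                  (le_antisymm ((complexity_termT_le (n := n) n).trans (by simp)) (Nat.zero_le _))
                  (fun k hk hkn => (complexity_termT_le (n := n) k).trans (by rw [if_pos ⟨hk, hkn⟩]))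
            _ = 2 * n - 1 := by omega
        · rw [if_neg hb1, if_neg hb1, ← C_0, complexity_C_holds]

/-- `Σ_{e ≤ n} (2e - 1) ≤ n²` (natural subtraction: the `e = 0` term is `0`). [folklore] -/
theorem sum_two_mul_sub_one_le (m : ℕ) : ∑ e ∈ Finset.range (m + 1), (2 * e - 1) ≤ m ^ 2 := by
  induction m with
  | zero => simp
  | succ m ih =>
    rw [Finset.sum_range_succ, (by omega : 2 * (m + 1) - 1 = 2 * m + 1)]
    nlinarith [ih]

/-- **The count**: `Σ_{a<3} Σ_{b<n} Σ_{e≤n} costN ≤ n(n+1) + (n+1) + (n-2)n² + (n+1) + (2n-1) ≤ n³`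
for `n ≥ 6`. [folklore] -/
theorem sum_costN_le (hn : 6 ≤ n) :
    ∑ a ∈ Finset.range 3, ∑ b ∈ Finset.range n, ∑ e ∈ Finset.range (n + 1), costN n a b e ≤
      n ^ 3 := by
  -- block 0
  have h0 : ∑ b ∈ Finset.range n, ∑ e ∈ Finset.range (n + 1), costN n 0 b e ≤ n * (n + 1) := by
    calc ∑ b ∈ Finset.range n, ∑ e ∈ Finset.range (n + 1), costN n 0 b e
        ≤ ∑ b ∈ Finset.range n, ∑ e ∈ Finset.range (n + 1), 1 :=
          Finset.sum_le_sum fun b _ => Finset.sum_le_sum fun e _ => by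
            unfold costN; split_ifs <;> omega
      _ = n * (n + 1) := by simp
  -- block 1
  set R : ℕ → ℕ := fun b => ∑ e ∈ Finset.range (n + 1), costN n 1 b e with hR
  have hR0 : R 0 ≤ n + 1 := by
    calc R 0 ≤ ∑ e ∈ Finset.range (n + 1), 1 :=
          Finset.sum_le_sum fun e _ => by unfold costN; split_ifs <;> omega
      _ = n + 1 := by simp
  have hRmid : ∀ b, 1 ≤ b → b + 2 ≤ n → R b ≤ n ^ 2 := by
    intro b hb1 hb2
    calc R b = ∑ e ∈ Finset.range (n + 1), (2 * e - 1) :=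
          Finset.sum_congr rfl fun e _ => by
            unfold costN
            simp only [one_ne_zero, if_false, if_true, if_pos hb2, if_neg (show b ≠ 0 by omega)]
      _ ≤ n ^ 2 := sum_two_mul_sub_one_le n
  have hRlast : R (n - 1) = 0 := by
    refine Finset.sum_eq_zero fun e _ => ?_
    unfold costN
    simp only [one_ne_zero, if_false, if_true, if_neg (show ¬ (n - 1 + 2 ≤ n) by omega)]
  have h1 : ∑ b ∈ Finset.range n, R b ≤ (n + 1) + (n - 2) * n ^ 2 := by
    have hsplit : Finset.range n = Finset.range (n - 2 + 1 + 1) := by congr 1; omega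
    rw [hsplit, Finset.sum_range_succ, Finset.sum_range_succ', (by omega : n - 2 + 1 = n - 1),
      hRlast, add_zero]
    have hmid : ∑ b ∈ Finset.range (n - 2), R (b + 1) ≤ (n - 2) * n ^ 2 := by
      calc ∑ b ∈ Finset.range (n - 2), R (b + 1) ≤ ∑ _b ∈ Finset.range (n - 2), n ^ 2 :=
            Finset.sum_le_sum fun b hb => hRmid (b + 1) (by omega)
              (by have := Finset.mem_range.mp hb; omega)
        _ = (n - 2) * n ^ 2 := by simp
    omega
  -- block 2
  set R2 : ℕ → ℕ := fun b => ∑ e ∈ Finset.range (n + 1), costN n 2 b e with hR2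
  have hR20 : R2 0 ≤ n + 1 := by
    calc R2 0 ≤ ∑ e ∈ Finset.range (n + 1), 1 :=
          Finset.sum_le_sum fun e _ => by unfold costN; split_ifs <;> omega
      _ = n + 1 := by simp
  have hR21 : R2 1 = 2 * n - 1 := by
    calc R2 1 = ∑ e ∈ Finset.range (n + 1), (if e = 0 then 2 * n - 1 else 0) :=
          Finset.sum_congr rfl fun e _ => by unfold costN; simp
      _ = 2 * n - 1 := by rw [Finset.sum_ite_eq']; simp
  have hR2rest : ∀ b, 2 ≤ b → R2 b = 0 := by
    intro b hb
    refine Finset.sum_eq_zero fun e _ => ?_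
    unfold costN
    simp only [(by norm_num : (2 : ℕ) ≠ 0), (by norm_num : (2 : ℕ) ≠ 1), if_false,
      if_neg (show b ≠ 0 by omega), if_neg (show ¬ (b = 1 ∧ e = 0) by omega)]
  have h2 : ∑ b ∈ Finset.range n, R2 b ≤ (n + 1) + (2 * n - 1) := by
    have hsplit : Finset.range n = Finset.range (n - 2 + 1 + 1) := by congr 1; omega
    rw [hsplit, Finset.sum_range_succ', Finset.sum_range_succ']
    have hzero : ∑ b ∈ Finset.range (n - 2), R2 (b + 1 + 1) = 0 :=
      Finset.sum_eq_zero fun b _ => hR2rest _ (by omega)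
    rw [hzero, zero_add, hR21]
    omega
  -- total
  rw [Finset.sum_range_succ, Finset.sum_range_succ, Finset.sum_range_one]
  obtain ⟨m, rfl⟩ : ∃ m, n = m + 2 := ⟨n - 2, by omega⟩
  have hm : 4 ≤ m := by omega
  have hmm : 4 * m ≤ m * m := Nat.mul_le_mul_right m hm
  simp only [Nat.add_sub_cancel] at h1
  have htot : (m + 2) * (m + 2 + 1) + ((m + 2 + 1) + m * (m + 2) ^ 2) +
      ((m + 2 + 1) + (2 * (m + 2) - 1)) ≤ (m + 2) ^ 3 := by
    have : 2 * (m + 2) - 1 = 2 * m + 3 := by omega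
    rw [this]
    nlinarith [hmm]
  calc _ ≤ (m + 2) * (m + 2 + 1) + ((m + 2 + 1) + m * (m + 2) ^ 2) +
        ((m + 2 + 1) + (2 * (m + 2) - 1)) := add_le_add (add_le_add h0 h1) h2
    _ ≤ (m + 2) ^ 3 := htot

/-- `step (idx a b e) = stepN a b e`. [folklore] -/
@[simp] theorem step_idx (a : Fin 3) (b : Fin n) (e : Fin (n + 1)) :
    step c (idx a b e) = stepN c a b e := by
  simp [step, idx]

/-- **Total cost of the chain**: `Σ_t L(step t) ≤ n³` for `n ≥ 6`. [cite: Burgisser2000, Rem. 2.7] -/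
theorem sum_complexity_step_le (hn : 6 ≤ n) : ∑ t : Idx n, complexity (step c t) ≤ n ^ 3 := by
  have hre : ∑ t : Idx n, complexity (step c t) =
      ∑ a : Fin 3, ∑ b : Fin n, ∑ e : Fin (n + 1), complexity (stepN c a b e) := by
    rw [← Fintype.sum_equiv toLex (fun p : Fin 3 × (Fin n ×ₗ Fin (n + 1)) =>
      complexity (step c (toLex p))) (fun t => complexity (step c t)) (fun _ => rfl),
      Fintype.sum_prod_type]
    refine Finset.sum_congr rfl fun a _ => ?_
    rw [← Fintype.sum_equiv toLex (fun q : Fin n × Fin (n + 1) =>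
      complexity (step c (toLex (a, toLex q)))) (fun q => complexity (step c (toLex (a, q))))
      (fun _ => rfl), Fintype.sum_prod_type]
    refine Finset.sum_congr rfl fun b _ => Finset.sum_congr rfl fun e _ => ?_
    exact congrArg complexity (step_idx c a b e)
  rw [hre]
  calc ∑ a : Fin 3, ∑ b : Fin n, ∑ e : Fin (n + 1), complexity (stepN c a b e)
      ≤ ∑ a : Fin 3, ∑ b : Fin n, ∑ e : Fin (n + 1), costN n a b e :=
        Finset.sum_le_sum fun a _ => Finset.sum_le_sum fun b _ => Finset.sum_le_sum fun e _ =>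
          complexity_stepN_le c (by omega) a b e
    _ = ∑ a ∈ Finset.range 3, ∑ b ∈ Finset.range n, ∑ e ∈ Finset.range (n + 1),
          costN n a b e := by
        rw [Fin.sum_univ_eq_sum_range (fun a => ∑ b : Fin n, ∑ e : Fin (n + 1), costN n a b e)]
        refine Finset.sum_congr rfl fun a _ => ?_
        rw [Fin.sum_univ_eq_sum_range (fun b => ∑ e : Fin (n + 1), costN n a b e)]
        refine Finset.sum_congr rfl fun b _ => ?_
        exact Fin.sum_univ_eq_sum_range (fun e => costN n a b e) (n + 1)
    _ ≤ n ^ 3 := sum_costN_le hn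

end Count

/-! ### F. The theorem -/

/-- **Separable coefficient tensors are succinct at exponent 3.** For every `n ≥ 6` and every
table of univariate coefficient sequences `c_l : ℕ → ℂ` there is `Λ ∈ SmallCircuits ℂ n 3`
(degree `≤ n`, size `≤ n³`) with `coeff_μ Λ = ∏_l c_l(μ_l)` for every `|μ| ≤ n` — the tree's
`stub_separableCoeff` (exponent `8`) re-costed by the truncated-product dynamic programme in one
circuit (`complexity_chain_le`). [cite: ForbesShpilkaVolk2018, Construction 25 and Fact 26] -/
theorem separableCoeff_three :
    ∀ n : ℕ, 6 ≤ n → ∀ c : Fin n → ℕ → ℂ,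
      ∃ Λ ∈ SmallCircuits ℂ n 3, ∀ μ : degLEMonomials n,
        MvPolynomial.coeff (μ : Fin n →₀ ℕ) Λ = ∏ i : Fin n, c i ((μ : Fin n →₀ ℕ) i) := by
  intro n hn c
  refine ⟨trunc c, ⟨totalDegree_trunc_le c, ?_⟩, fun μ => coeff_trunc c μ μ.2⟩
  -- the output is entry `(2, 1, 0)` of the table; the chain bound prices it by the total step cost
  have hout : trunc c = tab c (idx ⟨2, by norm_num⟩ ⟨1, by omega⟩ ⟨0, by omega⟩) := by
    rw [tab_idx]; simp [tabN]
  rw [hout]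
  calc complexity (tab c (idx ⟨2, by norm_num⟩ ⟨1, by omega⟩ ⟨0, by omega⟩))
      ≤ ∑ s : Idx n, complexity (step c s) :=
        complexity_chain_le_linearOrder (tab c) (step c)
          (fun t => tab_eq_aeval_step c (by omega) t) _
    _ ≤ n ^ 3 := sum_complexity_step_le c hn

end SeparableCoeffThree

end Summit.ValiantsHypothesis.ValiantsHypothesis.Theorems.BarrierLever.SuccinctHittingSetsForVP

end
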